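import Summits.BirchSwinnertonDyer.BirchSwinnertonDyer.Theorems.ByReductionTypeAtTwoRankOneAtTwoBigImageOddLocalOneDoorBottomAssemblyNeg
import Summits.BirchSwinnertonDyer.BirchSwinnertonDyer.Theorems.ByReductionTypeAtTwoRankOneAtTwoBigImageOddLocalOneDoorBottomCrossTransport
import Summits.BirchSwinnertonDyer.BirchSwinnertonDyer.Theorems.ByReductionTypeAtTwoRankOneAtTwoBigImageOddLocalOneDoorBottomCebotarevCopy
import HarnessLib

/-!
# Route ByReductionTypeAtTwo, crux `RankOneAtTwoBigImageOddLocal` (stmt-BirchSwinnertonDyer-23715), LINE v8.10 `one_door_analytic`: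
# the bottom rung at `Δ_W < 0` REDUCED TO THE FIRST-LAYER CLASSES — `FirstDescentLeavesAtTwoBottomNeg ⟸ FirstLayerClassesAtTwoBottomNeg` + print

Lead prover seat `bsd-line-fkl-p1` g12 (2026-08-28), `--supports stmt-BirchSwinnertonDyer-23715` (helper).  THEOREMS ONLY; no definition, no named
fact introduced, no `sorry`; BSD is not proved by any of this.

Closes the one displayed plumbing input of `nonempty_firstDescentInput_neg` (`…OneDoorBottomAssemblyNeg.lean`): the CROSS Čebotarev field `ceb₂'`
for the datum's model `Wd`.  §1 `cross_field_twist` — for the twist EQUATION `W^{(d_K)}` in the currency `KolNeg` / `plOfNat`, from the width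
seat fkl-p2 g10's `ceb₂'_rat` (restrictions to `K` distinct) and `not_mem_torsionLocalKer_twist_of_copy` + `ceb₁_rat` (the «twin copy of `y`»);
§2 `cross_field_model` — transported to any model `V • W^{(d_K)} = Wd` (`cross_field_of_iso`); §3 **`firstDescentLeavesAtTwoBottomNeg_of_classes`**:
`FirstDescentLeavesAtTwoBottomNeg ⟸ FirstLayerClassesAtTwoBottomNeg` modulo Gross–Zagier, Kolyvagin, modularity, Hoffstein–Luo — i.e. the corner
U₀⁻ of the crux's upper index law is, by kernel glue, EXACTLY route GenusKolyvaginAtTwo's item 24880 at `(M, m, l) = (1, 1, ℓ)` + descent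
(`FirstLayerClassesAtTwoBottomNeg`) + Cassels–Tate + the primary printed facts.

References: [GrossLMS1991] §§3, 6, 10; [McCallumLMS1991] §3 Cor. 3.2, p. 299; [Kolyvagin1989Izv] §3; [SilvermanAEC2009] X.§4.
-/

set_option autoImplicit false
-- the Theorems namespace of this sub repeats the summit name by design (D-0017 nested layout)
set_option linter.dupNamespace false

noncomputable section

open scoped Classical

namespace Summit.BirchSwinnertonDyer.BirchSwinnertonDyer.Theorems.RankOneAtTwoOneDoor

open WeierstrassCurve NumberField IsDedekindDomain Literature.NumberTheory.EllipticCurves Literature.NumberTheory.EllipticCurves.ModularForms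
  Literature.NumberTheory.GaloisRepresentations
  Summit.BirchSwinnertonDyer.Rank1Residual.F1Sign2
  Summit.BirchSwinnertonDyer.Rank1Residual.F1Sign2.TranspositionDoor
  Summit.BirchSwinnertonDyer.BirchSwinnertonDyer.Theorems.GenusExact
  Summit.BirchSwinnertonDyer.BirchSwinnertonDyer.Theorems.GenusExact.VisiblePairAtTwo

/-! ### §1 The cross field for the twist equation, currency `KolNeg` / `plOfNat` -/

/-- **The cross Čebotarev field `ceb₂'` for the twist EQUATION `W^{(d_K)}`, UNRESTRICTED** (habitat: `W` globally minimal non-CM, `Δ_W < 0`,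
`ρ_{W,2^n}` onto, `K = ℚ(θ)` imaginary quadratic with `θ² = d_K` odd, `d_K·(−|Δ_W|)` not a square): every non-zero `s' ∈ H¹(ℚ, W^{(d_K)}[2])` and
non-zero `y ∈ H¹(ℚ, W[2])` have a prime `ℓ` with `KolNeg W K ℓ` at whose place neither is strict — the generic case is `ceb₂'_rat`, the twin copy
`hPsiKT (res s') = res y` is `ceb₁_rat` for `y` plus `not_mem_torsionLocalKer_twist_of_copy`. [cite: McCallumLMS1991, §3 Cor. 3.2 and p. 299]
[cite: Kolyvagin1989Izv, §3] -/
theorem cross_field_twist (W : WeierstrassCurve ℚ) [W.IsElliptic] [W.IsGloballyMinimal] [NeZero (W.conductorNorm ℤ)]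
    (hcm : ¬ W.HasCM) (hΔ : W.Δ < 0) (K : Type) [Field K] [NumberField K] (hK : IsImaginaryQuadratic K)
    (hodd : Odd (NumberField.discr K)) (hns : ¬ IsSquare ((NumberField.discr K : ℚ) * -|W.Δ|))
    (hρ : ∀ n : ℕ, W.HasSurjectiveModNGaloisRep (2 ^ n : ℕ))
    {θ : K} (hθ : θ ∉ Set.range (algebraMap ℚ K)) (hc : θ ^ 2 = algebraMap ℚ K ((NumberField.discr K : ℤ) : ℚ))
    [(W.quadraticTwist ((NumberField.discr K : ℤ) : ℚ)).IsElliptic]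
    (y : galH1Torsion W 2) (hy0 : y ≠ 0) (q₀ : RatPlace) :
    ∀ s' : galH1Torsion (W.quadraticTwist ((NumberField.discr K : ℤ) : ℚ)) 2, s' ≠ 0 →
      (∀ v : RatPlace, v ≠ q₀ → s' ∈ locAt (W.quadraticTwist ((NumberField.discr K : ℤ) : ℚ)) 2 v) →
      ∃ ℓ, KolNeg W K ℓ ∧ s' ∉ strictAt (W.quadraticTwist ((NumberField.discr K : ℤ) : ℚ)) 2 (plOfNat ℓ) ∧ y ∉ strictAt W 2 (plOfNat ℓ) := by
  intro s' hs0 _hs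
  have hinjK := hinjK_of_habitat W K hK hΔ hρ hns
  by_cases hcopy : hPsiKT W K hθ hc ((2 : ℕ) : ℤ) (resTorsion (W.quadraticTwist ((NumberField.discr K : ℤ) : ℚ)) K ((2 : ℕ) : ℤ) s') =
      resTorsion W K ((2 : ℕ) : ℤ) y
  · obtain ⟨ℓ, -, hFrob, hKol, hidx, hloc⟩ :=
      ceb₁_rat (W.conductorNorm ℤ) W dvd_rfl hcm hΔ hK hodd hns hρ hθ hc hinjK y hy0 0
    have hℓv := natCast_mem_primesEquiv_symm hKol.1
    refine ⟨ℓ, ⟨hFrob, hKol, hidx⟩, ?_, ?_⟩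
    · rw [plOfNat_of_prime hKol.1, strictAt_inl]
      exact not_mem_torsionLocalKer_twist_of_copy (W.conductorNorm ℤ) W dvd_rfl hΔ hK hodd hθ hc hKol hFrob hℓv s' y hcopy (hloc _ hℓv)
    · rw [plOfNat_of_prime hKol.1, strictAt_inl]
      exact hloc _ hℓv
  · obtain ⟨ℓ, -, hFrob, hKol, hidx, hloc⟩ :=
      ceb₂'_rat (W.conductorNorm ℤ) W dvd_rfl hcm hΔ hK hodd hns hρ hθ hc hinjK s' y hs0 hy0 hcopy 0
    have hℓv := natCast_mem_primesEquiv_symm hKol.1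
    refine ⟨ℓ, ⟨hFrob, hKol, hidx⟩, ?_, ?_⟩
    · rw [plOfNat_of_prime hKol.1, strictAt_inl]
      exact (hloc _ hℓv).1
    · rw [plOfNat_of_prime hKol.1, strictAt_inl]
      exact (hloc _ hℓv).2

/-! ### §2 The cross field for a model of the twist -/

/-- **The cross field `ceb₂'` for any MODEL `Wd` of the twist** (`V • W^{(d_K)} = Wd`), transported from `cross_field_twist` by `cross_field_of_iso`.
[cite: McCallumLMS1991, §3 Cor. 3.2] [cite: SilvermanAEC2009, X.§4] -/
theorem cross_field_model (W : WeierstrassCurve ℚ) [W.IsElliptic] [W.IsGloballyMinimal] [NeZero (W.conductorNorm ℤ)]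
    (hcm : ¬ W.HasCM) (hΔ : W.Δ < 0) (K : Type) [Field K] [NumberField K] (hK : IsImaginaryQuadratic K)
    (hodd : Odd (NumberField.discr K)) (hns : ¬ IsSquare ((NumberField.discr K : ℚ) * -|W.Δ|))
    (hρ : ∀ n : ℕ, W.HasSurjectiveModNGaloisRep (2 ^ n : ℕ))
    {θ : K} (hθ : θ ∉ Set.range (algebraMap ℚ K)) (hc : θ ^ 2 = algebraMap ℚ K ((NumberField.discr K : ℤ) : ℚ))
    [(W.quadraticTwist ((NumberField.discr K : ℤ) : ℚ)).IsElliptic]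
    {Wd : WeierstrassCurve ℚ} {V : VariableChange ℚ} (hWd : V • W.quadraticTwist ((NumberField.discr K : ℤ) : ℚ) = Wd)
    (q₀ : RatPlace) (y : galH1Torsion W 2) (s : galH1Torsion Wd 2) (hy0 : y ≠ 0) (hs0 : s ≠ 0)
    (hs : ∀ w : RatPlace, w ≠ q₀ → s ∈ locAt Wd 2 w) :
    ∃ ℓ, KolNeg W K ℓ ∧ s ∉ strictAt Wd 2 (plOfNat ℓ) ∧ y ∉ strictAt W 2 (plOfNat ℓ) :=
  cross_field_of_iso hWd (KolNeg W K) plOfNat q₀ y (cross_field_twist W hcm hΔ K hK hodd hns hρ hθ hc y hy0 q₀) s hs0 hs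

/-! ### §3 U₀⁻ reduced to the first-layer classes -/

/-- **`FirstDescentLeavesAtTwoBottomNeg ⟸ FirstLayerClassesAtTwoBottomNeg`** modulo Gross–Zagier, Kolyvagin, modularity, Hoffstein–Luo: at a
bottom-rung datum with `Δ_W < 0` the record `FirstDescentInput W Wd` is `nonempty_firstDescentInput_neg` with the first-layer classes supplied by
`FirstLayerClassesAtTwoBottomNeg` and the cross field by `cross_field_model` (habitat from `kolyvaginAdmissible_of_doorAdmissible`,
`exists_sq_eq_discr_not_mem_range`, `isElliptic_quadraticTwist`).  The whole corner U₀⁻ (`DoorIndexLawUpperCAtTwoBottomNeg`) is thus kernel glue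
over `S_pub4`, Cassels–Tate and `FirstLayerClassesAtTwoBottomNeg` (frame `doorIndexLawUpperCAtTwoBottom_of_leaves`, split
`firstDescentLeavesAtTwoBottom_of_neg_of_pos`). [cite: GrossLMS1991, §10] [cite: Kolyvagin1989Izv, §3] [cite: McCallumLMS1991, Cor. 3.2] -/
theorem firstDescentLeavesAtTwoBottomNeg_of_classes
    (hGZ : ∀ (N : ℕ) [NeZero N] (W : WeierstrassCurve ℚ) (K : Type) [Field K] [NumberField K], gross_zagier N W K)
    (hKo : ∀ (N : ℕ) [NeZero N] (W : WeierstrassCurve ℚ) (K : Type) [Field K] [NumberField K], kolyvagin N W K)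
    (hnf : exists_isNewformOf) (hHL : HoffsteinLuo1997_exists_twist_L_one_ne_zero)
    (hcl : FirstLayerClassesAtTwoBottomNeg) : FirstDescentLeavesAtTwoBottomNeg := by
  intro W _ _ _ hCM hsurj hT hc hr K _ _ hK hadm hLt Dt H ι P hP Wd _ _ Cd hWd hmin hodd hm hΔ
  have h2K : Module.finrank ℚ K = 2 := hK.1
  have hD0 : ((NumberField.discr K : ℤ) : ℚ) ≠ 0 := by exact_mod_cast NumberField.discr_ne_zero K
  haveI : (W.quadraticTwist ((NumberField.discr K : ℤ) : ℚ)).IsElliptic := W.isElliptic_quadraticTwist hD0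
  obtain ⟨hdodd, -, hns, -⟩ := kolyvaginAdmissible_of_doorAdmissible W hadm
  obtain ⟨θ, hθ, hθsq⟩ := Literature.NumberTheory.EllipticCurves.exists_sq_eq_discr_not_mem_range K h2K
  refine nonempty_firstDescentInput_neg hGZ hKo hnf hHL W hCM hsurj hT hr K hK hadm hLt Dt H ι P hP Wd Cd hWd hmin hm hΔ
    (fun q₀ hq₀ hq₀d hjac hdivK y hymem hyres =>
      hcl W hCM hsurj hT hc hr K hK hadm hLt Dt H ι P hP Wd Cd hWd hmin hodd hm hΔ q₀ hq₀ hq₀d hjac hdivK y hymem hyres)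
    (fun q₀ y s hy0 hs0 hs => ?_)
  exact cross_field_model W hCM hΔ K hK hdodd hns hsurj hθ (by exact_mod_cast hθsq) hWd q₀ y s hy0 hs0 hs

end Summit.BirchSwinnertonDyer.BirchSwinnertonDyer.Theorems.RankOneAtTwoOneDoor

end
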